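import Literature.Combinatorics.SimpleGraph.GraphDivisorsChipFiring
import Literature.Combinatorics.SimpleGraph.LinearOrderDivisors
import Literature.Combinatorics.SimpleGraph.DollarGame
import HarnessLib

/-!
# Dhar's burning algorithm (reduced divisors are those with a burning order), and
# «`D` is `q`-reduced iff `K⁺ − D` is `q`-critical»: reduced divisors of each degree are counted by
# the spanning trees (Baker–Shokrieh 2013, §5.1 and §5.2; Baker–Norine 2007, §3.1)

Sources (held, read at the page; statements VERBATIM). M. Baker, F. Shokrieh, *Chip-firing games,
potential theory on graphs, and spanning trees*, J. Combin. Theory Ser. A 120 (2013) 164–182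
[BakerShokrieh2013] (held text `paper:arxiv-1107.1313`, chunks p0011–p0012), §5.1 «Dhar's
algorithm»: «In order to check whether or not `D` is `q`-reduced using the definition, one needs
to check for all subsets `A ⊆ V(G)∖{q}` whether or not there is a vertex `v ∈ A` such that
`D(v) < outdeg_A(v)`. But there is in fact a much more efficient procedure called Dhar's burning
algorithm (after Dhar [Dhar90]). […] A fire starts at vertex `q` and proceeds along each edge
adjacent to `q`. At each vertex `v ≠ q`, there are `D(v)` firefighters, each of whom can control
fires in a single direction (i.e., edge) leading into `v`. Whenever there are fires approaching
`v` in more than `D(v)` directions, the fire burns through `v` and proceeds to burn along all the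
other edges incident to `v`. The divisor `D` is `q`-reduced iff the fire eventually burns through
every vertex of `G`. […] **Dhar's Burning Algorithm.** Input: A divisor `D ∈ Div(G)`, and a vertex
`q ∈ V(G)`. Output: TRUE if `D` is `q`-reduced, and FALSE if `D` is not `q`-reduced. If `D(v) < 0`
for some `v ∈ V(G)∖{q}` output FALSE and Stop. Let `A₀ = V(G)` and `v₀ = q`. For `1 ≤ i ≤ n − 1`:
Let `A_i = A_{i−1}∖{v_{i−1}}`. If for all `v ∈ A_i`, `D(v) ≥ outdeg_{A_i}(v)`, output FALSE and
Stop. Else let `v_i ∈ A_i` be any vertex with `D(v_i) < outdeg_{A_i}(v_i)`. Output TRUE.»; §5.2: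
«For a fixed vertex `q`, `q`-critical configurations provide another set of representatives for
equivalence classes of divisors (see, e.g., [Biggs97, Biggs99]). There is a simple relationship
between reduced and critical divisors: `D` is `q`-reduced if and only if `K⁺ − D` is `q`-critical,
where `K⁺ = Σ_{v ∈ V(G)} (deg(v) − 1)(v)` [BN1].» M. Baker, S. Norine [BakerNorine2007], §3.1:
«Our reduced divisors are closely related to the "critical configurations" considered by Biggs».

## What is formalised (vocabulary: `IsReduced` of `ReducedDivisors`, `bnDual` (`K⁺ − D`) of
## `GraphDivisorsChipFiring`, `orderDivisor` (`ν_P`) of `LinearOrderDivisors`, and the lineage's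
## `ChipFiring.IsQCritical` / `IsDiffuse` / `IsRecurrent` (Godsil–Royle §14.11–§14.13))

* **Dhar's algorithm, correctness**: `isReduced_of_forall_lt_card` (a burning order — every
  `v ≠ q` has more previously burnt neighbours than `D(v)` — certifies `q`-reducedness: output
  TRUE is correct) and **`isReduced_iff_exists_burningOrder`** (`D` is `q`-reduced iff `D ≥ 0` off
  `q` and some linear order starting at `q` burns every vertex, i.e. `D(v) < |{w ∼ v : w <_P v}|`
  for all `v ≠ q`; equivalently `D ≤ ν_P` off `q`: `isReduced_iff_exists_le_orderDivisor`) — since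
  for a `q`-reduced `D` the algorithm never stops early, this is exactly «Output TRUE iff `D` is
  `q`-reduced»;
* **«`D` is `q`-reduced iff `K⁺ − D` is `q`-critical»**: `card_filter_adj_add_card_sdiff`
  (`|N(v) ∩ A| + outdeg_A(v) = deg(v)`), **`isReduced_iff_isQCritical`** (with the lineage's
  `q`-critical states, whose value at `q` is immaterial and here normalised to `deg(q)`), through
  Godsil–Royle's «recurrent ⟺ diffuse» (`isRecurrent_iff_isDiffuse`);
* hence B–N's reduced divisors and Godsil–Royle's `q`-critical states are the same system of
  representatives: **`card_isReduced_eq_card_spanningTrees`** (the `q`-reduced divisors of any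
  fixed degree `d` are equinumerous with the spanning trees), from the lineage's
  `card_isQCritical_eq_card_spanningTrees`.

Theorems only; no `sorry`; no named facts.
-/

open Finset SimpleGraph Matrix
open Literature.Combinatorics.SimpleGraph.ChipFiring

namespace Literature.Combinatorics.SimpleGraph.BakerNorine

variable {V : Type*} [Fintype V] [DecidableEq V] {G : SimpleGraph V} [DecidableRel G.Adj]

/-! ### §1 Dhar's burning algorithm -/

section Dhar

/-- **Dhar's algorithm is sound (output TRUE is correct).** If the vertices can be burnt in some
order (`ρ`, any ranking) so that each `v ≠ q` has `D(v) <` the number of its neighbours burnt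
earlier («whenever there are fires approaching `v` in more than `D(v)` directions, the fire burns
through `v`»), and `D ≥ 0` off `q`, then `D` is `q`-reduced: for `A ∌ q` take the vertex of `A`
burnt first. [cite: BakerShokrieh2013, §5.1 (Dhar's Burning Algorithm)] -/
theorem isReduced_of_forall_lt_card {q : V} {D : V → ℤ} (ρ : V → ℕ) (h0 : ∀ v, v ≠ q → 0 ≤ D v)
    (hburn : ∀ v, v ≠ q → D v < #{w ∈ G.neighborFinset v | ρ w < ρ v}) : IsReduced G q D := by
  refine ⟨h0, fun A hA hqA => ?_⟩
  obtain ⟨v, hvA, hmin⟩ := Finset.exists_min_image A ρ hA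
  have hvq : v ≠ q := fun h => hqA (h ▸ hvA)
  refine ⟨v, hvA, (hburn v hvq).trans_le ?_⟩
  exact_mod_cast Finset.card_le_card fun w hw => by
    rw [Finset.mem_filter] at hw
    rw [Finset.mem_sdiff]
    exact ⟨hw.1, fun hwA => by have := hmin w hwA; omega⟩

/-- **Dhar's burning algorithm, correctness.** `D` is `q`-reduced iff `D(v) ≥ 0` for `v ≠ q` and
there is a burning order — a linear order `v₀ = q, v₁, …, v_{n−1}` of `V(G)` with
`D(v_i) < outdeg_{A_i}(v_i)`, `A_i = {v_i, …, v_{n−1}}`, i.e. each `v ≠ q` has more earlier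
neighbours than `D(v)` («The divisor `D` is `q`-reduced iff the fire eventually burns through every
vertex of `G`»; for a `q`-reduced `D` the algorithm's choice of `v_i` always exists, so it outputs
TRUE, and TRUE is correct by `isReduced_of_forall_lt_card`).
[cite: BakerShokrieh2013, §5.1 (Dhar's Burning Algorithm)] -/
theorem isReduced_iff_exists_burningOrder {q : V} {D : V → ℤ} :
    IsReduced G q D ↔ (∀ v, v ≠ q → 0 ≤ D v) ∧
      ∃ ρ : V → ℕ, Function.Injective ρ ∧ ρ q = 0 ∧
        ∀ v, v ≠ q → D v < #{w ∈ G.neighborFinset v | ρ w < ρ v} := by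
  constructor
  · intro hD
    refine ⟨hD.1, ?_⟩
    -- run the construction of Theorem 3.3 on `D` with `D(q)` replaced by `−1` (still `q`-reduced)
    have hD' : IsReduced G q (Function.update D q (-1)) :=
      ⟨fun v hv => by rw [Function.update_of_ne hv]; exact hD.1 v hv,
        fun A hA hqA => by
          obtain ⟨v, hv, hlt⟩ := hD.2 A hA hqA
          exact ⟨v, hv, by rwa [Function.update_of_ne (fun h : v = q => hqA (h ▸ hv))]⟩⟩
    obtain ⟨ρ, hρ, hle⟩ := hD'.exists_le_orderDivisor (by rw [Function.update_self]; norm_num)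
    -- restart the order at `q`: `ρ′(q) = 0`, `ρ′(v) = ρ(v) + 1` otherwise
    refine ⟨fun v => if v = q then 0 else ρ v + 1, fun v w h => ?_, if_pos rfl, fun v hv => ?_⟩
    · by_cases hv : v = q <;> by_cases hw : w = q
      · rw [hv, hw]
      · simp only [hv, hw, if_true, if_false] at h
        omega
      · simp only [hv, hw, if_true, if_false] at h
        omega
      · simp only [hv, hw, if_false] at h
        exact hρ (by omega)
    · have h1 := hle v
      rw [Function.update_of_ne hv, orderDivisor_apply] at h1
      have h2 : #{w ∈ G.neighborFinset v | ρ w < ρ v} ≤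
          #{w ∈ G.neighborFinset v | (if w = q then 0 else ρ w + 1) < (if v = q then 0 else ρ v + 1)} := by
        refine Finset.card_le_card fun w hw => ?_
        rw [Finset.mem_filter] at hw ⊢
        refine ⟨hw.1, ?_⟩
        rw [if_neg hv]
        split_ifs
        · omega
        · omega
      have h3 : (#{w ∈ G.neighborFinset v | ρ w < ρ v} : ℤ) ≤
          #{w ∈ G.neighborFinset v | (if w = q then 0 else ρ w + 1) < (if v = q then 0 else ρ v + 1)} := by
        exact_mod_cast h2
      linarith
  · rintro ⟨h0, ρ, -, -, hburn⟩
    exact isReduced_of_forall_lt_card ρ h0 hburn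

/-- Equivalently, with B–N's divisors of linear orders: `D` is `q`-reduced iff `D ≥ 0` off `q` and
`D ≤ ν_P` off `q` for some linear order `<_P` beginning at `q` (the inequality
«`D(v_k) ≤ outdeg_{A_k}(v_k) − 1 = ν_P(v_k)`» of the proof of B–N Theorem 3.3, now as a
characterisation). [cite: BakerShokrieh2013, §5.1] [cite: BakerNorine2007, Theorem 3.3 (proof)] -/
theorem isReduced_iff_exists_le_orderDivisor {q : V} {D : V → ℤ} :
    IsReduced G q D ↔ (∀ v, v ≠ q → 0 ≤ D v) ∧
      ∃ ρ : V → ℕ, Function.Injective ρ ∧ ρ q = 0 ∧ ∀ v, v ≠ q → D v ≤ orderDivisor G ρ v := by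
  rw [isReduced_iff_exists_burningOrder]
  refine and_congr_right fun _ => exists_congr fun ρ => and_congr_right fun _ =>
    and_congr_right fun _ => forall_congr' fun v => forall_congr' fun _ => ?_
  rw [orderDivisor_apply]
  omega

end Dhar

/-! ### §2 Reduced divisors and `q`-critical states -/

section Critical

omit [DecidableEq V] in
/-- `|N(v) ∩ A| + outdeg_A(v) = deg(v)`. [folklore] -/
private theorem card_filter_adj_add_card_sdiff [DecidableEq V] (A : Finset V) (v : V) :
    #(A.filter (G.Adj v)) + #(G.neighborFinset v \ A) = G.degree v := by
  have h1 : A.filter (G.Adj v) = G.neighborFinset v ∩ A := by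
    ext w
    simp only [Finset.mem_filter, Finset.mem_inter, mem_neighborFinset]
    exact and_comm
  rw [h1, add_comm, Finset.card_sdiff_add_card_inter, card_neighborFinset_eq_degree]

/-- **«`D` is `q`-reduced if and only if `K⁺ − D` is `q`-critical»** — with Godsil–Royle's
`q`-critical states of the chip-firing game (`q`-stable and recurrent), whose value at `q` plays no
role in reducedness and is normalised here to `deg(q)`; `G` connected. (P1) is `q`-stability of
`K⁺ − D`; (P2) for `A ∌ q` is diffuseness of `K⁺ − D` on `A` («some vertex of `A` has at least as
many chips as its valency in `A`»), and recurrent ⟺ diffuse (Godsil–Royle Theorem 14.11.1).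
[cite: BakerShokrieh2013, §5.2] [cite: BakerNorine2007, §3.1] -/
theorem isReduced_iff_isQCritical (hG : G.Connected) {q : V} {D : V → ℤ} :
    IsReduced G q D ↔ IsQCritical G q (Function.update (bnDual G D) q (G.degree q)) := by
  rw [isQCritical_iff, isRecurrent_iff_isDiffuse G hG, isQStable_iff, isDiffuse_iff]
  constructor
  · rintro ⟨h1, h2⟩
    refine ⟨fun v hv => ?_, fun Y hY => ?_⟩
    · rw [Function.update_of_ne hv, bnDual_apply]
      have := h1 v hv
      omega
    · by_cases hqY : q ∈ Y
      · refine ⟨q, hqY, ?_⟩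
        rw [Function.update_self]
        have := (card_filter_adj_add_card_sdiff (G := G) Y q).le
        exact_mod_cast le_of_add_le_left this
      · obtain ⟨v, hvY, hlt⟩ := h2 Y hY hqY
        refine ⟨v, hvY, ?_⟩
        rw [Function.update_of_ne (fun h : v = q => hqY (h ▸ hvY)), bnDual_apply]
        have := card_filter_adj_add_card_sdiff (G := G) Y v
        omega
  · rintro ⟨h1, h2⟩
    refine ⟨fun v hv => ?_, fun A hA hqA => ?_⟩
    · have := h1 v hv
      rw [Function.update_of_ne hv, bnDual_apply] at this
      omega
    · obtain ⟨v, hvA, hle⟩ := h2 A hA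
      have hvq : v ≠ q := fun h => hqA (h ▸ hvA)
      rw [Function.update_of_ne hvq, bnDual_apply] at hle
      refine ⟨v, hvA, ?_⟩
      have := card_filter_adj_add_card_sdiff (G := G) A v
      omega

/-- **Reduced divisors of a fixed degree are counted by the spanning trees** («`q`-critical
configurations provide another set of representatives for equivalence classes of divisors […]
`D` is `q`-reduced if and only if `K⁺ − D` is `q`-critical»; the count of `q`-critical states is
Godsil–Royle Theorem 14.13.3, in the tree): for every `d`,
`#{D : q-reduced, deg D = d} = #{spanning trees}`. [cite: BakerShokrieh2013, §5.2 (with §1)] -/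
theorem card_isReduced_eq_card_spanningTrees (hG : G.Connected) (q : V) (d : ℤ) :
    Nat.card {D : V → ℤ // IsReduced G q D ∧ ∑ v, D v = d} =
      Nat.card {T : SimpleGraph V // T ≤ G ∧ T.IsTree} := by
  rw [← card_isQCritical_eq_card_spanningTrees G hG q]
  -- the bijection `D ↦ K⁺ − D` (normalised at `q`), inverse determined by the degree `d`
  refine Nat.card_congr
    { toFun := fun D => ⟨Function.update (bnDual G D.1) q (G.degree q),
        (isReduced_iff_isQCritical hG).1 D.2.1, Function.update_self _ _ _⟩
      invFun := fun s => ⟨Function.update (fun v => (G.degree v : ℤ) - 1 - s.1 v) q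
          (d - ∑ u ∈ univ.erase q, ((G.degree u : ℤ) - 1 - s.1 u)), ?_, ?_⟩
      left_inv := fun D => ?_
      right_inv := fun s => ?_ }
  · -- `q`-reduced, by the criterion: its normalised dual is `s` again
    rw [isReduced_iff_isQCritical hG]
    convert s.2.1 using 1
    funext v
    by_cases hv : v = q
    · rw [hv, Function.update_self, s.2.2]
    · rw [Function.update_of_ne hv, bnDual_apply, Function.update_of_ne hv]
      ring
  · -- degree `d`
    rw [← Finset.add_sum_erase _ _ (mem_univ q), Function.update_self]
    have : ∑ u ∈ univ.erase q, Function.update (fun v => (G.degree v : ℤ) - 1 - s.1 v) q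
        (d - ∑ u ∈ univ.erase q, ((G.degree u : ℤ) - 1 - s.1 u)) u
        = ∑ u ∈ univ.erase q, ((G.degree u : ℤ) - 1 - s.1 u) :=
      Finset.sum_congr rfl fun u hu => by rw [Function.update_of_ne (Finset.ne_of_mem_erase hu)]
    rw [this]
    ring
  · -- left inverse
    apply Subtype.ext
    funext v
    dsimp only
    by_cases hv : v = q
    · subst hv
      simp only [Function.update_self]
      have hsum := D.2.2
      rw [← Finset.add_sum_erase _ _ (mem_univ v)] at hsum
      have : ∑ u ∈ univ.erase v, ((G.degree u : ℤ) - 1 -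
          Function.update (bnDual G D.1) v (G.degree v : ℤ) u) = ∑ u ∈ univ.erase v, D.1 u :=
        Finset.sum_congr rfl fun u hu => by
          rw [Function.update_of_ne (Finset.ne_of_mem_erase hu), bnDual_apply]
          ring
      rw [this]
      omega
    · simp only [Function.update_of_ne hv, bnDual_apply]
      ring
  · -- right inverse
    apply Subtype.ext
    funext v
    dsimp only
    by_cases hv : v = q
    · subst hv
      rw [Function.update_self, s.2.2]
    · simp only [Function.update_of_ne hv, bnDual_apply]
      ring

end Critical

end Literature.Combinatorics.SimpleGraph.BakerNorine
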